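import Literature.Geometry.Lorentzian.GaussFormulaTangentialGeneral
import Literature.Geometry.Lorentzian.TranslationalKIDImmersion
import Literature.Geometry.Lorentzian.MinkowskiFlat
import Literature.Geometry.Lorentzian.GradientSection
import Literature.Geometry.Lorentzian.StaticKillingLapseEquation
import HarnessLib

/-!
# Spacelike hypersurfaces of Minkowski space-time carry the four translational KIDs

Converse of `TranslationalKIDImmersion.lean`. There, data `(h, k)` on a chart domain carrying four
solutions `(N_a, Y_a)` of the translational KID system of Beig–Chruściel 1996, App. A,

  `h(∇ᵤY_a, w) = −N_a k(u, w)`,  `dN_a(u) = −k(u, Y_a)`,  `−N_a N_b + h(Y_a, Y_b) = η_{ab}`,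

were integrated to a spacelike immersion into Minkowski space-time with `f^*η = h`, `K_ν = k`,
`ν = (−ε_a N_a)_a`, `df = (ε_a h(Y_a, ·))_a` — i.e. `∂_a = N_a ν + df(Y_a)` along `f`. Here the
easy direction, with the same sign conventions: for ANY smooth spacelike immersion `f : N → ℝ⁴`
(any manifold `N` without boundary) with timelike unit normal `ν`, the lapse–shift components
`(N_a, Y_a)` of the translational Killing fields `∂_a = N_a ν + df(Y_a)` solve that system for the
induced metric `f^*η`, its Levi-Civita connection and the second fundamental form `K_ν`:

* `PseudoRiemannianMetric.mvfderiv_lapse_eq_of_kid_of_gram` — general lemma (any metric, any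
  manifold): the lapse equation `dN_a(V) = −k(V, Y_a)` follows from the shift equation and the
  constancy of the Gram pairings `h(Y_a, Y_b) − N_a N_b` when some `N_{a₀} ≠ 0` (metric
  compatibility and Leibniz, as in `KillingInitialDataPairing.mvfderiv_kidPairing_eq_zero`, give
  `N_b E_a + N_a E_b = 0` for the defects `E_a`);
* `Minkowski.bilin_basisVector_basisVector`, `Minkowski.mdifferentiableAt_const_section` —
  `η(∂_a, ∂_b) = η_{ab}`; the constant sections of `Tℝ⁴` are differentiable;
* `Minkowski.kids_of_spacelikeImmersion` — **unconditional form**: for `dim N = 3` the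
  lapse–shift components exist and are explicit, `N_a = −η(∂_a, ν)`,
  `Y_a = grad_{f^*η} η(∂_a, f(·))` (`GradientSection.mdifferentiableAt_sharp_mvfderiv`; the
  splitting by `eq_zero_of_val_mfderiv_eq_zero_of_val_normal_eq_zero`,
  `StaticKillingLapseEquation.lean`), so every spacelike hypersurface of Minkowski space-time
  carries the four translational KIDs;
* `Minkowski.kids_of_lapse_shift` — **main result**: the shift equation is the `3 + 1` split of
  `∇∂_a = 0` (`PseudoRiemannianMetric.val_leviCivita_mfderiv_of_eq_lapse_shift`,
  `GaussFormulaTangentialGeneral.lean`; `ModelSpace.leviCivita_const`), the Gram identity is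
  `η(∂_a, ∂_b)` expanded with `η(ν, ν) = −1`, `η(ν, df) = 0`, and the lapse equation follows
  (`N₀² = 1 + h(Y₀, Y₀) ≠ 0`).

Together with `InitialDataSet.exists_spacelikeImmersion_minkowski_of_kids` this is the local
equivalence "`(h, k)` is a slice of Minkowski space-time iff it carries four translational KIDs
with Gram matrix `η`" underlying the geometric half of the rigid positive energy theorem
(Beig–Chruściel, J. Math. Phys. 37 (1996), Thm. 4.1, §4 with App. A; Moncrief 1975: Killing
fields of a vacuum development restrict to KIDs). Theorems only; no definitions, no named facts.

## References

* R. Beig, P. T. Chruściel, *Killing vectors in asymptotically flat space-times. I.*, J. Math.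
  Phys. 37 (1996) 1939–1961, §4 and App. A, (A.11)–(A.11.0). [BeigChrusciel1996]
* V. Moncrief, *Spacetime symmetries and linearization stability of the Einstein equations. I*,
  J. Math. Phys. 16 (1975) 493–498, §III. [Moncrief1975]
* R. M. Wald, *General Relativity*, Chicago 1984, §10.2, (10.2.11)–(10.2.13). [Wald1984]
* B. O'Neill, *Semi-Riemannian geometry*, Academic Press 1983, Ch. 3, Lemma 3.14 and Thm. 3.11;
  Ch. 4, Lemma 3. [ONeill1983]
-/

noncomputable section

open Bundle Set Function Manifold
open scoped Manifold ContDiff Topology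

namespace Literature.Geometry.Lorentzian

/-! ### The second KID equation follows from the first and the Gram identity -/

section KIDTwo

variable {E' : Type*} [NormedAddCommGroup E'] [NormedSpace ℝ E'] {H' : Type*} [TopologicalSpace H']
  {I' : ModelWithCorners ℝ E' H'} {M' : Type*} [TopologicalSpace M'] [ChartedSpace H' M']
  [IsManifold I' ∞ M'] {n : ℕ∞ω}
  (g : PseudoRiemannianMetric I' n E' (TangentSpace I' : M' → Type _))
  [Fact (1 ≤ n)] [FiniteDimensional ℝ E'] [CompleteSpace E'] [g.HasLeviCivita]

/-- **The lapse equation of the translational KID system follows from the shift equation and the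
constancy of the Gram matrix.** Let `g` be a `C¹` pseudo-Riemannian metric (any signature, any
manifold) with Levi-Civita connection `∇`, `k` a field of bilinear forms, and `(N_a, Y_a)_a` a
family of functions and vector fields, differentiable at `x`, such that in the direction `V x`
the first KID equation `g(∇_V Y_a, w) = −N_a k(V, w)` holds for every `a`, the pairings
`g(Y_a, Y_b) − N_a N_b` are constant functions, and some lapse `N_{a₀}(x) ≠ 0`. Then the second
KID equation `dN_a(V) = −k(V, Y_a)` holds at `x` for every `a`: differentiating the constant
pairings (metric compatibility and the Leibniz rule, as in `mvfderiv_kidPairing_eq_zero`) gives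
`N_b E_a + N_a E_b = 0` for the defects `E_a = dN_a(V) + k(V, Y_a)`, whence `E_{a₀} = 0` and then
`E_a = 0`. In Beig–Chruściel, J. Math. Phys. 37 (1996), App. A both equations (A.11), (A.11.0) are
read off the Sen-parallel spinor; this lemma records that the second is forced by the first once
the Gram matrix is known (as it is along `Σ`, §4).
[cite: BeigChrusciel1996, App. A (A.11)–(A.11.0)] -/
theorem PseudoRiemannianMetric.mvfderiv_lapse_eq_of_kid_of_gram {ι : Type*}
    (k : Π x : M', TangentSpace I' x →L[ℝ] TangentSpace I' x →L[ℝ] ℝ) {x : M'}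
    {V : Π x : M', TangentSpace I' x} (hV : MDiffAt (T% V) x)
    {N : ι → M' → ℝ} {Y : ι → Π x : M', TangentSpace I' x}
    (hN : ∀ a, MDiffAt (N a) x) (hY : ∀ a, MDiffAt (T% (Y a)) x)
    (hDY : ∀ a w, g.val x (g.leviCivita (Y a) x (V x)) w = -(N a x * k x (V x) w))
    {c : ι → ι → ℝ} (hG : ∀ (y : M') a b, g.val y (Y a y) (Y b y) - N a y * N b y = c a b)
    {a₀ : ι} (h0 : N a₀ x ≠ 0) (a : ι) :
    mvfderiv I' (N a) x (V x) = -(k x (V x) (Y a x)) := by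
  have hcompat : g.IsCompatible g.leviCivita := (isLeviCivita_leviCivita_holds (g := g)).2
  -- `N_b E_a + N_a E_b = 0` for the defects `E_a = dN_a(V) + k(V, Y_a)`
  have key : ∀ a b, N b x * (mvfderiv I' (N a) x (V x) + k x (V x) (Y a x)) +
      N a x * (mvfderiv I' (N b) x (V x) + k x (V x) (Y b x)) = 0 := by
    intro a b
    have hA : MDiffAt (fun y ↦ g.val y (Y a y) (Y b y)) x :=
      g.mdifferentiableAt_val_apply (hY a) (hY b)
    have hB : MDiffAt (fun y ↦ N a y * N b y) x := (hN a).mul (hN b)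
    have h1 : mvfderiv I' (fun y ↦ g.val y (Y a y) (Y b y)) x (V x) =
        -(N a x * k x (V x) (Y b x)) - N b x * k x (V x) (Y a x) := by
      rw [hcompat hV (hY a) (hY b), hDY a (Y b x), g.symm x (Y a x), hDY b (Y a x)]
      ring
    have h2 : mvfderiv I' (fun y ↦ N a y * N b y) x (V x) =
        N a x * mvfderiv I' (N b) x (V x) + N b x * mvfderiv I' (N a) x (V x) := by
      rw [mvfderiv_fun_mul (hN a) (hN b), _root_.add_apply, _root_.smul_apply, _root_.smul_apply,
        smul_eq_mul, smul_eq_mul]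
    have h3 : mvfderiv I' (fun y ↦ g.val y (Y a y) (Y b y) - N a y * N b y) x (V x) = 0 := by
      rw [show (fun y ↦ g.val y (Y a y) (Y b y) - N a y * N b y) = fun _ ↦ c a b from
        funext fun y ↦ hG y a b, mvfderiv_const]
      rfl
    rw [mvfderiv_fun_sub hA hB, _root_.sub_apply, h1, h2] at h3
    linear_combination -h3
  have hE0 : mvfderiv I' (N a₀) x (V x) + k x (V x) (Y a₀ x) = 0 := by
    have h : 2 * N a₀ x * (mvfderiv I' (N a₀) x (V x) + k x (V x) (Y a₀ x)) = 0 := by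
      linear_combination key a₀ a₀
    exact (mul_eq_zero.mp h).resolve_left (mul_ne_zero two_ne_zero h0)
  have h := key a a₀
  rw [hE0, mul_zero, add_zero] at h
  linear_combination (mul_eq_zero.mp h).resolve_left h0

end KIDTwo

namespace Minkowski

variable {E' : Type*} [NormedAddCommGroup E'] [NormedSpace ℝ E'] [FiniteDimensional ℝ E']
  [CompleteSpace E'] {H' : Type*} [TopologicalSpace H'] {I' : ModelWithCorners ℝ E' H'}
  [I'.Boundaryless] {N : Type*} [TopologicalSpace N] [ChartedSpace H' N] [IsManifold I' ∞ N]

/-- `η(∂_a, ∂_b) = η_{ab} = diag(−1, 1, 1, 1)` (O'Neill 1983, Ch. 3, p. 55).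
[cite: ONeill1983, Ch. 3, p. 55] -/
theorem bilin_basisVector_basisVector (a b : Fin 4) :
    bilin (E4.basisVector a) (E4.basisVector b) =
      if a = b then (if a = 0 then -1 else 1) else 0 := by
  fin_cases a <;> fin_cases b <;> simp [E4.basisVector, Fin.sum_univ_three]

/-- The constant sections `x ↦ ∂_a` of `Tℝ⁴` are differentiable. [folklore] -/
theorem mdifferentiableAt_const_section (v : E4) (x : E4) :
    MDifferentiableAt 𝓘(ℝ, E4) (𝓘(ℝ, E4).prod 𝓘(ℝ, E4))
      (fun y : E4 ↦ (TotalSpace.mk' E4 y (v : TangentSpace 𝓘(ℝ, E4) y) : TangentBundle 𝓘(ℝ, E4) E4))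
      x :=
  ModelSpace.mdifferentiableAt_section_iff.mpr (differentiableAt_const v)

/-- **A spacelike hypersurface of Minkowski space-time carries the four translational KIDs.** Let
`f : N → ℝ⁴` be a smooth spacelike immersion into Minkowski space-time `(ℝ⁴, η)` with timelike
unit normal `ν` (`η(ν, ν) = −1`, smooth lift), `h = f^*η` the induced metric with its Levi-Civita
connection `∇` and `K = K_ν` the second fundamental form (`K(u, w) = η(D_u ν, df w)`). Decompose
the constant — hence parallel — translational Killing fields `∂_a` of `ℝ⁴` along the slice into
lapse and shift, `∂_a = N_a ν + df(Y_a)` (`N_a` differentiable functions, `Y_a` differentiable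
vector fields of `N`). Then `(N_a, Y_a)` solve the translational KID system of Beig–Chruściel
1996, App. A, (A.11)–(A.11.0), with Minkowskian Gram matrix:

  `h(∇ᵤY_a, w) = −N_a K(u, w)`,  `dN_a(u) = −K(u, Y_a)`,  `−N_a N_b + h(Y_a, Y_b) = η_{ab}`.

Proof: the shift equation is the `3 + 1` split of `∇∂_a = 0` along the slice
(`val_leviCivita_mfderiv_of_eq_lapse_shift`, `GaussFormulaTangentialGeneral.lean`, with
`ModelSpace.leviCivita_const`); the Gram identity is `η(∂_a, ∂_b) = η_{ab}` expanded with
`η(ν, ν) = −1`, `η(ν, df ·) = 0`; and the lapse equation then follows from both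
(`mvfderiv_lapse_eq_of_kid_of_gram`, `TranslationalKIDImmersion.lean`; `N₀² = 1 + h(Y₀, Y₀) ≠ 0`).
This is the converse of `InitialDataSet.exists_spacelikeImmersion_minkowski_of_kids` (same sign
conventions), i.e. the easy direction of "data are a slice of Minkowski space-time iff they carry
four translational KIDs with Gram matrix `η`" underlying the proof of the rigid positive energy
theorem, Beig–Chruściel, J. Math. Phys. 37 (1996), Thm. 4.1 (§4 and App. A); Moncrief 1975, §III
(Killing fields of a development restrict to KIDs).
[cite: BeigChrusciel1996, §4 and App. A (A.11)–(A.11.0)] -/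
theorem kids_of_lapse_shift [smoothMetric.toPseudoRiemannianMetric.HasLeviCivita]
    (hpb : PseudoRiemannianMetric.contMDiff_pullbackBilin 𝓘(ℝ, E4) E4 I' N ∞) {f : N → E4}
    (hfi : smoothMetric.toPseudoRiemannianMetric.IsSpacelikeImmersion I' f)
    {ν : NormalField 𝓘(ℝ, E4) f}
    (hν : ContMDiff I' 𝓘(ℝ, E4).tangent ∞
      (fun x ↦ (TotalSpace.mk' E4 (f x) (ν x) : TangentBundle 𝓘(ℝ, E4) E4)))
    (hun : smoothMetric.toPseudoRiemannianMetric.IsUnitNormal I' f ν (-1))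
    {Nf : Fin 4 → N → ℝ} (hNd : ∀ a y, MDifferentiableAt I' 𝓘(ℝ, ℝ) (Nf a) y)
    {Z : Fin 4 → Π y : N, TangentSpace I' y} (hZ : ∀ a y, MDiffAt (T% (Z a)) y)
    (hsplit : ∀ a y, (E4.basisVector a : TangentSpace 𝓘(ℝ, E4) (f y)) =
      Nf a y • ν y + mfderiv I' 𝓘(ℝ, E4) f y (Z a y)) :
    haveI := (smoothMetric.toPseudoRiemannianMetric.inducedMetric f hpb hfi).hasLeviCivita
    (∀ a (y : N) (u w : TangentSpace I' y),
      (smoothMetric.toPseudoRiemannianMetric.inducedMetric f hpb hfi).val y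
          ((smoothMetric.toPseudoRiemannianMetric.inducedMetric f hpb hfi).leviCivita (Z a) y u)
          w =
        -(Nf a y * smoothMetric.toPseudoRiemannianMetric.secondFundamentalForm I' f ν y u w)) ∧
    (∀ a (y : N) (u : TangentSpace I' y), mvfderiv I' (Nf a) y u =
        -(smoothMetric.toPseudoRiemannianMetric.secondFundamentalForm I' f ν y u (Z a y))) ∧
    ∀ (y : N) a b, -(Nf a y * Nf b y) +
        (smoothMetric.toPseudoRiemannianMetric.inducedMetric f hpb hfi).val y (Z a y) (Z b y) =
      if a = b then (if a = 0 then -1 else 1) else 0 := by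
  set g := smoothMetric.toPseudoRiemannianMetric with hg_def
  haveI := (g.inducedMetric f hpb hfi).hasLeviCivita
  set gN := g.inducedMetric f hpb hfi with hgN
  -- the shift equation: the `3 + 1` split of `∇∂_a = 0`
  have hK1 : ∀ a (y : N) (u w : TangentSpace I' y), gN.val y (gN.leviCivita (Z a) y u) w =
      -(Nf a y * g.secondFundamentalForm I' f ν y u w) := by
    intro a y u w
    have h := g.val_leviCivita_mfderiv_of_eq_lapse_shift hpb hfi hν hun.1
      (X := fun x : E4 ↦ (E4.basisVector a : TangentSpace 𝓘(ℝ, E4) x))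
      (mdifferentiableAt_const_section _) (hNd a) (hZ a) (hsplit a) y u w
    rw [ModelSpace.leviCivita_const (g := g) (G₀ := bilin) (fun _ ↦ rfl) (f y) (E4.basisVector a),
      _root_.zero_apply, map_zero, _root_.zero_apply] at h
    linear_combination -h
  -- the Gram identity: `η(∂_a, ∂_b)` expanded in lapse and shift
  have hG : ∀ (y : N) a b, -(Nf a y * Nf b y) + gN.val y (Z a y) (Z b y) =
      if a = b then (if a = 0 then -1 else 1) else 0 := by
    intro y a b
    have key : ∀ (p q : ℝ) (n v w : E4), bilin (p • n + v) (q • n + w) =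
        p * q * bilin n n + p * bilin n w + q * bilin v n + bilin v w := by
      intro p q n v w
      simp only [map_add, map_smul, _root_.add_apply, _root_.smul_apply, smul_eq_mul]
      ring
    have e2 : bilin (Nf a y • ν y + mfderiv I' 𝓘(ℝ, E4) f y (Z a y))
        (Nf b y • ν y + mfderiv I' 𝓘(ℝ, E4) f y (Z b y)) =
        if a = b then (if a = 0 then -1 else 1) else 0 := by
      rw [← hsplit a y, ← hsplit b y]
      exact bilin_basisVector_basisVector a b
    have e3 := (key (Nf a y) (Nf b y) (ν y) (mfderiv I' 𝓘(ℝ, E4) f y (Z a y))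
      (mfderiv I' 𝓘(ℝ, E4) f y (Z b y))).symm.trans e2
    have hnn : bilin (ν y) (ν y) = -1 := hun.2 y
    have hnz : bilin (ν y) (mfderiv I' 𝓘(ℝ, E4) f y (Z b y)) = 0 := hun.1 y (Z b y)
    have hzn : bilin (mfderiv I' 𝓘(ℝ, E4) f y (Z a y)) (ν y) = 0 := by
      rw [bilin_symm]; exact hun.1 y (Z a y)
    have hzz : bilin (mfderiv I' 𝓘(ℝ, E4) f y (Z a y)) (mfderiv I' 𝓘(ℝ, E4) f y (Z b y)) =
        gN.val y (Z a y) (Z b y) := by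
      rw [hgN, PseudoRiemannianMetric.inducedMetric_val, PseudoRiemannianMetric.inducedBilin_apply]
      rfl
    rw [hnn, hnz, hzn, hzz] at e3
    linear_combination e3
  refine ⟨hK1, fun a y u ↦ ?_, hG⟩
  -- the lapse equation, from the other two
  haveI : FiniteDimensional ℝ (TangentSpace I' y) := inferInstanceAs (FiniteDimensional ℝ E')
  set k : Π y : N, TangentSpace I' y →L[ℝ] TangentSpace I' y →L[ℝ] ℝ := fun y ↦
    show E' →L[ℝ] E' →L[ℝ] ℝ from
      LinearMap.toContinuousBilinearMap
        (show E' →ₗ[ℝ] E' →ₗ[ℝ] ℝ from g.secondFundamentalForm I' f ν y) with hk_def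
  have hk : ∀ (y : N) (v w : TangentSpace I' y),
      k y v w = g.secondFundamentalForm I' f ν y v w := fun _ _ _ ↦ rfl
  have h0 : Nf 0 y ≠ 0 := by
    have h := hG y 0 0
    simp only [if_true] at h
    have hnonneg : 0 ≤ gN.val y (Z 0 y) (Z 0 y) := by
      by_cases hz : Z 0 y = 0
      · rw [hz, map_zero]
      · rw [hgN, PseudoRiemannianMetric.inducedMetric_val]
        exact (hfi.2 y (Z 0 y) hz).le
    intro h00
    rw [h00] at h
    nlinarith [h, hnonneg]
  have key := gN.mvfderiv_lapse_eq_of_kid_of_gram k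
    (FiberBundle.mdifferentiableAt_extend (I := I') (F := E') u)
    (fun a ↦ hNd a y) (fun a ↦ hZ a y) (fun a w ↦ by rw [hk]; exact hK1 a y _ w)
    (c := fun a b ↦ if a = b then (if a = 0 then -1 else 1) else 0)
    (fun y' a b ↦ by linarith [hG y' a b]) h0 a
  rwa [FiberBundle.extend_apply_self, hk] at key

/-- **Every spacelike hypersurface of Minkowski space-time carries the four translational KIDs**
(unconditional form of `kids_of_lapse_shift`). For a smooth spacelike immersion `f : N³ → ℝ⁴`
(`dim N = 3`, no boundary) with timelike unit normal `ν` of smooth lift, the lapse–shift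
components of the translations `∂_a` exist and are explicit,

  `N_a = −η(∂_a, ν)`,  `Y_a = grad_{f^*η} η(∂_a, f(·))`  (`(f^*η)(Y_a, w) = η(∂_a, df w)`),

they are differentiable, split `∂_a = N_a ν + df(Y_a)` (the vector `∂_a − N_a ν − df(Y_a)` is
`η`-orthogonal to `ν` and to `df(TN)`, hence zero: `T_{f y}ℝ⁴ = df(T_yN) ⊕ ℝν`,
`eq_zero_of_val_mfderiv_eq_zero_of_val_normal_eq_zero`), and therefore solve the translational
KID system (A.11)–(A.11.0) with Gram matrix `η` (`kids_of_lapse_shift`). Beig–Chruściel, J. Math.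
Phys. 37 (1996), §4 and App. A; Wald 1984, (10.2.11)–(10.2.13) (`t^a = N n^a + N^a`).
[cite: BeigChrusciel1996, §4 and App. A (A.11)–(A.11.0)] -/
theorem kids_of_spacelikeImmersion [smoothMetric.toPseudoRiemannianMetric.HasLeviCivita]
    (hpb : PseudoRiemannianMetric.contMDiff_pullbackBilin 𝓘(ℝ, E4) E4 I' N ∞) {f : N → E4}
    (hfi : smoothMetric.toPseudoRiemannianMetric.IsSpacelikeImmersion I' f)
    {ν : NormalField 𝓘(ℝ, E4) f}
    (hν : ContMDiff I' 𝓘(ℝ, E4).tangent ∞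
      (fun x ↦ (TotalSpace.mk' E4 (f x) (ν x) : TangentBundle 𝓘(ℝ, E4) E4)))
    (hun : smoothMetric.toPseudoRiemannianMetric.IsUnitNormal I' f ν (-1))
    (hdim : Module.finrank ℝ E' = 3) :
    haveI := (smoothMetric.toPseudoRiemannianMetric.inducedMetric f hpb hfi).hasLeviCivita
    ∃ (Nf : Fin 4 → N → ℝ) (Z : Fin 4 → Π y : N, TangentSpace I' y),
      (∀ a y, Nf a y = -bilin (E4.basisVector a) (ν y)) ∧
      (∀ a (y : N) (w : TangentSpace I' y),
        (smoothMetric.toPseudoRiemannianMetric.inducedMetric f hpb hfi).val y (Z a y) w =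
          bilin (E4.basisVector a) (mfderiv I' 𝓘(ℝ, E4) f y w)) ∧
      (∀ a y, MDifferentiableAt I' 𝓘(ℝ, ℝ) (Nf a) y) ∧ (∀ a y, MDiffAt (T% (Z a)) y) ∧
      (∀ a y, (E4.basisVector a : TangentSpace 𝓘(ℝ, E4) (f y)) =
        Nf a y • ν y + mfderiv I' 𝓘(ℝ, E4) f y (Z a y)) ∧
      (∀ a (y : N) (u w : TangentSpace I' y),
        (smoothMetric.toPseudoRiemannianMetric.inducedMetric f hpb hfi).val y
            ((smoothMetric.toPseudoRiemannianMetric.inducedMetric f hpb hfi).leviCivita (Z a) y u)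
            w =
          -(Nf a y * smoothMetric.toPseudoRiemannianMetric.secondFundamentalForm I' f ν y u w)) ∧
      (∀ a (y : N) (u : TangentSpace I' y), mvfderiv I' (Nf a) y u =
          -(smoothMetric.toPseudoRiemannianMetric.secondFundamentalForm I' f ν y u (Z a y))) ∧
      ∀ (y : N) a b, -(Nf a y * Nf b y) +
          (smoothMetric.toPseudoRiemannianMetric.inducedMetric f hpb hfi).val y (Z a y) (Z b y) =
        if a = b then (if a = 0 then -1 else 1) else 0 := by
  set g := smoothMetric.toPseudoRiemannianMetric with hg_def
  haveI := (g.inducedMetric f hpb hfi).hasLeviCivita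
  set gN := g.inducedMetric f hpb hfi with hgN
  have hf : ContMDiff I' 𝓘(ℝ, E4) ∞ f := hfi.contMDiff_self
  -- the functions `η(∂_a, f)` and the maps `y ↦ ν y ∈ ℝ⁴`
  have hφ : ∀ a, ContMDiff I' 𝓘(ℝ, ℝ) ∞ fun y ↦ bilin (E4.basisVector a) (f y) := fun a ↦
    (bilin (E4.basisVector a)).contMDiff.comp hf
  have hνd : ∀ y, MDifferentiableAt I' 𝓘(ℝ, E4) (fun x ↦ (ν x : E4)) y := fun y ↦
    (ModelSpace.mdifferentiableAt_lift_iff.mp ((hν y).mdifferentiableAt (by simp))).2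
  -- lapse and shift
  set Nf : Fin 4 → N → ℝ := fun a y ↦ -bilin (E4.basisVector a) (ν y) with hNf
  set Z : Fin 4 → Π y : N, TangentSpace I' y := fun a y ↦
    gN.sharp y (mvfderiv I' (fun y ↦ bilin (E4.basisVector a) (f y)) y).toLinearMap with hZ_def
  have hZval : ∀ a (y : N) (w : TangentSpace I' y),
      gN.val y (Z a y) w = bilin (E4.basisVector a) (mfderiv I' 𝓘(ℝ, E4) f y w) := by
    intro a y w
    rw [hZ_def, PseudoRiemannianMetric.val_sharp_apply]
    change mfderiv I' 𝓘(ℝ, ℝ) (fun y ↦ bilin (E4.basisVector a) (f y)) y w = _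
    rw [show (fun y ↦ bilin (E4.basisVector a) (f y)) = (bilin (E4.basisVector a)) ∘ f from rfl,
      mfderiv_comp y (bilin (E4.basisVector a)).mdifferentiableAt
        ((hf y).mdifferentiableAt (by simp)), ContinuousLinearMap.mfderiv_eq]
    rfl
  have hNd : ∀ a y, MDifferentiableAt I' 𝓘(ℝ, ℝ) (Nf a) y := fun a y ↦
    ((-bilin (E4.basisVector a)).mdifferentiableAt.comp y (hνd y))
  have hZd : ∀ a y, MDiffAt (T% (Z a)) y := fun a y ↦
    gN.mdifferentiableAt_sharp_mvfderiv ((hφ a y).of_le (by exact WithTop.coe_le_coe.2 le_top))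
  -- the splitting `∂_a = N_a ν + df(Y_a)`
  have hsplit : ∀ a y, (E4.basisVector a : TangentSpace 𝓘(ℝ, E4) (f y)) =
      Nf a y • ν y + mfderiv I' 𝓘(ℝ, E4) f y (Z a y) := by
    intro a y
    have key : ∀ (e n z w : E4) (p : ℝ),
        bilin (e - (p • n + z)) w = bilin e w - p * bilin n w - bilin z w := by
      intro e n z w p
      simp only [map_sub, map_add, map_smul, _root_.sub_apply, _root_.add_apply,
        _root_.smul_apply, smul_eq_mul]
      ring
    refine sub_eq_zero.mp (g.eq_zero_of_val_mfderiv_eq_zero_of_val_normal_eq_zero hfi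
      (νy := ν y) (ε := -1) (hun.1 y) (hun.2 y) (by norm_num)
      (by rw [hdim]; exact finrank_euclideanSpace_fin) (fun u ↦ ?_) ?_)
    · have h1 := key (E4.basisVector a) (ν y) (mfderiv I' 𝓘(ℝ, E4) f y (Z a y))
        (mfderiv I' 𝓘(ℝ, E4) f y u) (Nf a y)
      have h2 : bilin (ν y) (mfderiv I' 𝓘(ℝ, E4) f y u) = 0 := hun.1 y u
      have h3 : bilin (mfderiv I' 𝓘(ℝ, E4) f y (Z a y)) (mfderiv I' 𝓘(ℝ, E4) f y u) =
          gN.val y (Z a y) u := by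
        rw [hgN, PseudoRiemannianMetric.inducedMetric_val,
          PseudoRiemannianMetric.inducedBilin_apply]
        rfl
      rw [h2, h3, hZval] at h1
      refine h1.trans ?_
      ring
    · have h1 := key (E4.basisVector a) (ν y) (mfderiv I' 𝓘(ℝ, E4) f y (Z a y)) (ν y) (Nf a y)
      have h2 : bilin (ν y) (ν y) = -1 := hun.2 y
      have h3 : bilin (mfderiv I' 𝓘(ℝ, E4) f y (Z a y)) (ν y) = 0 := by
        rw [bilin_symm]; exact hun.1 y (Z a y)
      rw [h2, h3] at h1
      refine h1.trans ?_
      show bilin (E4.basisVector a) (ν y) - -bilin (E4.basisVector a) (ν y) * -1 - 0 = 0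
      ring
  exact ⟨Nf, Z, fun _ _ ↦ rfl, hZval, hNd, hZd, hsplit,
    kids_of_lapse_shift hpb hfi hν hun hNd hZd hsplit⟩

end Minkowski

end Literature.Geometry.Lorentzian

end
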